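import Summits.AtomisticToContinuum.Crystallization.Theses.DisclinationRation
import Summits.AtomisticToContinuum.Crystallization.Theorems.HullExactificationCascadeHullGoodEverywhereSnap
import Literature.MathematicalPhysics.StatisticalMechanics.LennardJonesClusters
import Literature.MathematicalPhysics.StatisticalMechanics.LocalMatchingCompactness
import Literature.MathematicalPhysics.StatisticalMechanics.LocalLimitOfGroundStates

/-!
# `AlphabetGoodHullElement` (crux stmt-AtomisticToContinuum-15798, route `DisclinationRation`),
# negative side II: the existential choice of the hull element is load-bearing (flat hull elements)

The crux asks, for every sequence `x N` of Lennard-Jones ground states, for SOME rooted hull element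
`S ∋ 0` (translates `x (φ j) + τ j` two-way `ε`-matched with `S` on every ball, eventually in `j`)
that is `δ`-separated, relatively dense and everywhere alphabet-good.

This file (refuter, cdisprove seat, cycle 1) records, sorry-free and with the clauses SPELLED OUT
(no proposition is defined under `Summits/`), that the natural strengthening "EVERY rooted hull
element is relatively dense (let alone everywhere good)" is FALSE for EVERY ground-state sequence:

* `exists_flat_rooted_hullElement` — for every family `x` of finite configurations with a uniform
  minimal distance `δ > 0`, recentring `x (k+1)` at a particle of maximal first coordinate and
  extracting a locally convergent subsequence (compactness of `δ`-separated sets in the local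
  matching topology, `exists_subseq_forall_eventually_ballMatch`) yields a `δ`-separated rooted
  hull element contained in the closed half-space `{p | p 0 ≤ 0}` — a crystal SURFACE seen from
  one of its particles;
* `not_relDense_of_flat` — such a set is not relatively dense;
* `exists_rooted_hullElement_not_relDense` — hence every sequence of Lennard-Jones ground states
  (uniformly `1/3`-separated, `LennardJonesMinimalDistance_holds`) has a rooted, separated hull
  element that is NOT relatively dense, and `not_forall_rooted_hullElement_relDense` — the
  ∀-over-hull-elements strengthening of the crux is false (ground states exist for every `N`,
  `LennardJonesGroundStatesExist_holds`).

Moral: the hull of a ground-state sequence always contains surface elements, so a refutation of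
the crux can never come from surfaces or from boundedly many defects — a witness against the crux
must place non-good sites at bounded distance from EVERY particle of ALL large ground states; and a
proof must CHOOSE its centres (the clean-ball pigeonhole of `stub_alphabetCleanHullElement`).
This file does NOT refute the crux.  All `[folklore]` (Radin 1991 §2, hull of ground states;
Baake–Grimm 2013, Remark 5.6, local rubber topology).
-/

noncomputable section

namespace Summit.AtomisticToContinuum.Crystallization.Theorems.AlphabetGoodHullElementNegative

open Literature.MathematicalPhysics.StatisticalMechanics Filter Topology

/-- **Flat rooted hull elements exist for every uniformly separated family.** [folklore] -/
theorem exists_flat_rooted_hullElement (x : (N : ℕ) → (Fin N → EuclideanSpace ℝ (Fin 3))) {δ : ℝ}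
    (hδ : 0 < δ) (hsep : ∀ N, ∀ i j : Fin N, i ≠ j → δ ≤ dist (x N i) (x N j)) :
    ∃ S : Set (EuclideanSpace ℝ (Fin 3)), (∀ y ∈ S, ∀ z ∈ S, y ≠ z → δ ≤ dist y z) ∧
      (0 : EuclideanSpace ℝ (Fin 3)) ∈ S ∧
      (∃ φ : ℕ → ℕ, StrictMono φ ∧ ∃ τ : ℕ → EuclideanSpace ℝ (Fin 3), ∀ R ε : ℝ, 0 < ε →
        ∀ᶠ j : ℕ in Filter.atTop,
          (∀ s ∈ S, ‖s‖ ≤ R → ∃ i : Fin (φ j), dist (x (φ j) i + τ j) s ≤ ε) ∧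
          (∀ i : Fin (φ j), ‖x (φ j) i + τ j‖ ≤ R → ∃ s ∈ S, dist (x (φ j) i + τ j) s ≤ ε)) ∧
      ∀ s ∈ S, s 0 ≤ 0 := by
  classical
  have hc : ∀ k : ℕ, ∃ i₀ : Fin (k + 1), ∀ i : Fin (k + 1), x (k + 1) i 0 ≤ x (k + 1) i₀ 0 :=
    fun k => Finite.exists_max fun i : Fin (k + 1) => x (k + 1) i 0
  choose i₀ hi₀ using hc
  set c : ℕ → EuclideanSpace ℝ (Fin 3) := fun k => -x (k + 1) (i₀ k) with hcdef
  set Y : ℕ → Set (EuclideanSpace ℝ (Fin 3)) := fun k => Set.range fun i => x (k + 1) i + c k with hYdef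
  have hYsep : ∀ k, ∀ p ∈ Y k, ∀ q ∈ Y k, p ≠ q → δ ≤ dist p q := by
    intro k
    rintro _ ⟨i, rfl⟩ _ ⟨i', rfl⟩ hne
    rw [dist_add_right]
    exact hsep _ i i' fun h => hne (by simp [h])
  have hYflat : ∀ k, ∀ p ∈ Y k, p 0 ≤ 0 := by
    intro k
    rintro _ ⟨i, rfl⟩
    have := hi₀ k i
    simp only [hcdef, PiLp.add_apply, PiLp.neg_apply]
    linarith
  have h0Y : ∀ k, (0 : EuclideanSpace ℝ (Fin 3)) ∈ Y k := fun k => ⟨i₀ k, by simp [hcdef]⟩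
  obtain ⟨φ₁, S, hφ₁, hSsep, hlim⟩ := exists_subseq_forall_eventually_ballMatch hδ Y hYsep
  refine ⟨S, hSsep, ?_, ?_, ?_⟩
  · exact Summit.AtomisticToContinuum.Crystallization.Theorems.hge_mem_of_tendsto hδ hSsep hlim
      (Eventually.of_forall fun k => h0Y (φ₁ k)) tendsto_const_nhds
  · refine ⟨fun j => φ₁ j + 1, fun a b hab => Nat.add_lt_add_right (hφ₁ hab) 1, fun j => c (φ₁ j), ?_⟩
    intro R ε hε
    filter_upwards [hlim R ε hε] with j hj
    exact (ballMatch_zero_range_iff (fun i => x (φ₁ j + 1) i + c (φ₁ j)) ε R).1 hj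
  · intro s hs
    obtain ⟨hpY, hps⟩ := Summit.AtomisticToContinuum.Crystallization.Theorems.hge_exists_approx hδ
      (fun k => hYsep (φ₁ k)) hlim hs
    have hcont : Continuous fun p : EuclideanSpace ℝ (Fin 3) => p 0 := PiLp.continuous_apply 2 _ 0
    have hclosed : IsClosed {p : EuclideanSpace ℝ (Fin 3) | p 0 ≤ 0} :=
      isClosed_le hcont continuous_const
    exact hclosed.mem_of_tendsto hps (hpY.mono fun k hk => hYflat _ _ hk)

/-- A subset of the half-space `{p | p 0 ≤ 0}` is not relatively dense in `ℝ³`. [folklore] -/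
theorem not_relDense_of_flat {S : Set (EuclideanSpace ℝ (Fin 3))} (hS : ∀ s ∈ S, s 0 ≤ 0) :
    ¬ ∃ R₁ : ℝ, ∀ p : EuclideanSpace ℝ (Fin 3), ∃ y ∈ S, dist y p ≤ R₁ := by
  rintro ⟨R₁, hR₁⟩
  obtain ⟨y, hyS, hyq⟩ := hR₁ (EuclideanSpace.single (0 : Fin 3) (|R₁| + 1))
  have h := PiLp.dist_apply_le y (EuclideanSpace.single (0 : Fin 3) (|R₁| + 1)) 0
  rw [Real.dist_eq] at h
  have hq : (EuclideanSpace.single (0 : Fin 3) (|R₁| + 1) : EuclideanSpace ℝ (Fin 3)) 0 = |R₁| + 1 := by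
    simp
  rw [hq] at h
  have h' : |y 0 - (|R₁| + 1)| ≤ |R₁| := (h.trans hyq).trans (le_abs_self R₁)
  have h'' := (abs_le.1 h').1
  have hy := hS y hyS
  linarith

/-- **Every sequence of Lennard-Jones ground states has a rooted, separated hull element that is
NOT relatively dense** (a surface element of its hull). [folklore] -/
theorem exists_rooted_hullElement_not_relDense (x : (N : ℕ) → (Fin N → EuclideanSpace ℝ (Fin 3)))
    (hx : ∀ N, IsGroundState lennardJones (x N)) :
    ∃ S : Set (EuclideanSpace ℝ (Fin 3)), ∃ δ : ℝ, 0 < δ ∧ (∀ y ∈ S, ∀ z ∈ S, y ≠ z → δ ≤ dist y z) ∧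
      (0 : EuclideanSpace ℝ (Fin 3)) ∈ S ∧
      (∃ φ : ℕ → ℕ, StrictMono φ ∧ ∃ τ : ℕ → EuclideanSpace ℝ (Fin 3), ∀ R ε : ℝ, 0 < ε →
        ∀ᶠ j : ℕ in Filter.atTop,
          (∀ s ∈ S, ‖s‖ ≤ R → ∃ i : Fin (φ j), dist (x (φ j) i + τ j) s ≤ ε) ∧
          (∀ i : Fin (φ j), ‖x (φ j) i + τ j‖ ≤ R → ∃ s ∈ S, dist (x (φ j) i + τ j) s ≤ ε)) ∧
      ¬ ∃ R₁ : ℝ, ∀ p : EuclideanSpace ℝ (Fin 3), ∃ y ∈ S, dist y p ≤ R₁ := by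
  obtain ⟨δ, hδ, hsepall⟩ := LennardJonesMinimalDistance_holds
  obtain ⟨S, hSsep, h0, hHL, hflat⟩ :=
    exists_flat_rooted_hullElement x hδ fun N i j hij => hsepall N (x N) (hx N) i j hij
  exact ⟨S, δ, hδ, hSsep, h0, hHL, not_relDense_of_flat hflat⟩

/-- **Refuted strengthening of the crux**: it is false that EVERY rooted hull element of every
sequence of Lennard-Jones ground states is relatively dense — so the crux's `∃ S` cannot be
upgraded to `∀ S`, and relative denseness + everywhere-goodness must come from a CHOICE of centres.
[folklore] -/
theorem not_forall_rooted_hullElement_relDense :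
    ¬ ∀ x : (N : ℕ) → (Fin N → EuclideanSpace ℝ (Fin 3)), (∀ N, IsGroundState lennardJones (x N)) →
      ∀ S : Set (EuclideanSpace ℝ (Fin 3)), (0 : EuclideanSpace ℝ (Fin 3)) ∈ S →
        (∃ φ : ℕ → ℕ, StrictMono φ ∧ ∃ τ : ℕ → EuclideanSpace ℝ (Fin 3), ∀ R ε : ℝ, 0 < ε →
          ∀ᶠ j : ℕ in Filter.atTop,
            (∀ s ∈ S, ‖s‖ ≤ R → ∃ i : Fin (φ j), dist (x (φ j) i + τ j) s ≤ ε) ∧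
            (∀ i : Fin (φ j), ‖x (φ j) i + τ j‖ ≤ R → ∃ s ∈ S, dist (x (φ j) i + τ j) s ≤ ε)) →
        ∃ R₁ : ℝ, ∀ p : EuclideanSpace ℝ (Fin 3), ∃ y ∈ S, dist y p ≤ R₁ := by
  intro h
  choose x hx using LennardJonesGroundStatesExist_holds
  obtain ⟨S, δ, -, -, h0, hHL, hnot⟩ := exists_rooted_hullElement_not_relDense x hx
  exact hnot (h x hx S h0 hHL)

end Summit.AtomisticToContinuum.Crystallization.Theorems.AlphabetGoodHullElementNegative

end
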